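import Mathlib.Analysis.SpecialFunctions.Pow.Real
import Mathlib.Analysis.InnerProductSpace.PiL2
import Literature.Analysis.FluidPDE.LerayHopf
import Literature.Analysis.FluidPDE.MildSolution
import Literature.Analysis.FunctionSpaces.Complexify
import Literature.Analysis.FunctionSpaces.FourierSobolevNorm
import HarnessLib
import HarnessLib.Audit

-- provenance: harness21/H21/H21/Statements/NS/MildSolutions.lean @ 6da1538 (interim HEAD d8f2665); M5 mechanical rewrite
/-!
# Mild solutions of Navier–Stokes on `ℝ³`: Kato, Fujita–Kato, Rusin–Šverák
(family: NS, statements **ns.S13**, **ns.S14**; trunk FluidKinetic, outline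
`H21/Outlines/FluidKinetic.md`, item `NSMildSolutions`; namespace `Literature.NS`)

Physical space is `ℝ³ = EuclideanSpace ℝ (Fin 3)`; the force is `f = 0` throughout.

* **ns.S13** (Kato 1984, Thms. 1–4): for divergence-free `u₀ ∈ L³(ℝ³)` there is a local mild
  solution in `C([0,T); L³)`, unique in that class; if `‖u₀‖_{L³} ≤ δν` it is global and
  `‖u(t)‖_{L^q} ≤ C t^{-(1-3/q)/2}` (`3 ≤ q ≤ ∞`).
* **ns.S14** (Fujita–Kato 1964; Rusin–Šverák 2011): the same in `Ḣ^{1/2}(ℝ³)`; the threshold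
  `ρ_max = sup {ρ | ‖u₀‖_{Ḣ^{1/2}} < ρ ⇒ global regular solution}` and the existence of a
  *minimal blow-up datum* on the sphere `‖u₀‖_{Ḣ^{1/2}} = ρ_max` if `ρ_max < ∞`
  (Rusin–Šverák, Thm. 1.1).

## Conventions recalled from the prelude

* *Mild solution* means the accepted duality (very weak, Fabes–Jones–Rivière) form
  `Fluid.IsMildNSSolutionOn S ν f u₀ u` (`Prelude/FluidKinetic/MildSolution.lean`), equivalent
  to Kato's semigroup Duhamel formula in the classes used (Lemarié-Rieusset 2002, Thm. 11.2;
  accepted `Fluid.isMildNSSolutionOn_iff_duhamel_two`).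
* **`t = 0`.** With the prelude's device `Fluid.heatFlow φ 0 = φ` (`e^{0Δ} = id`), the `t = 0`
  clause of `IsMildNSSolutionOn (Ico 0 T)` is exactly the *weak* initial condition
  `∫⟪u 0 - u₀, φ⟫ = 0` for divergence-free tests (`Fluid.isMildNSSolutionFrom_zero_iff`), so the
  strong initial condition `u 0 = u₀` is added below as a genuine, non-contradictory conjunct.
* **Viscosity.** Every statement takes `0 < ν` explicitly (`Fluid.heatTest 0` is the identity
  semigroup). Smallness conditions are written `‖u₀‖ ≤ δ ν`, the form dictated by the scaling
  `u(t,x) ↦ ν⁻¹ u(ν⁻¹ t, x)` which maps viscosity `ν` to viscosity `1`.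
* **`Ḣ^{1/2}` (review finding 7b).** The accepted `MemHomSobolev s f` and
  `Function.eHomSobolevSeminorm s f` (`Prelude/Sobolev/FourierSobolevNorm.lean`, lines 113–118)
  are the **`Ḣ^s ∩ L²`** membership / seminorm (junk `∞` off `L²`); real fields enter through
  `EuclideanSpace.complexify`. Hence `fujita_kato_local`, `fujita_kato_global_small`,
  `rusinSverakRhoMax` and `RusinSverakQuestion` are the **finite-energy
  (`L² ∩ Ḣ^{1/2}`) versions**, which for the classical Fujita–Kato data are the usual
  statements. Rusin–Šverák's
  compactness argument, however, genuinely lives in the full homogeneous space `Ḣ^{1/2}` (the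
  minimal datum is a weak limit of rescaled data and need not have finite energy), so their
  Thm. 1.1 is stated (`rusin_sverak_minimal_blowup`) for the *pure* threshold
  `rusinSverakRhoMaxPure`, typed with the accepted bundled space `HomSobolev ℝ³ ℂ³ (1/2)` through
  the representation predicate `HomSobolev.Represents` (Fourier transform of the `L³` field `u₀`
  equals the stored weighted-`L²` class). The finite-energy analogue is recorded only as the
  registered OPEN statement `RusinSverakQuestion` (a `@[conjecture] def … : Prop`, not
  asserted and not a named fact; see "Open statement" below).

## Open statement (verdict clean-up 2026-08-16)

`RusinSverakQuestion` (name kept: the `…Conjecture` rename of CONVENTIONS §4 was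
prepared — the def has no Lean user — but is refused by the gate for a clean-up seat, a renamed
unproved `Prop` counting as a newly minted conjecture-citing fact (`literature.conjecture` /
`lint.fact-fanout`, dry run of 2026-08-16); the `…Question` form already marks a non-theorem, as
for the sibling open statements `BrueDeLellisQuestion21` / `…22` of `AnomalousDissipation.lean`,
and the route files `Theses/AmplitudeIndex`, `Theses/ThinOrFatPincer`,
`Theses/MinimalBlowupRigidity` of `Summits/NavierStokesRegularity` cite it by this name in
prose) is an OPEN PROBLEM
registered as a statement (CONVENTIONS §4: `@[conjecture] def … : Prop`, docstring
`OPEN CONJECTURE — … [status: open]`), not named-fact debt. Rusin–Šverák POSE question (Q) —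
"If `ρ_max` is finite, does there exist an initial datum `u₀ ∈ Ḣ^{1/2}` with
`‖u₀‖_{Ḣ^{1/2}} = ρ_max`, such that the solution `u` … develops a singularity in finite time?"
(arXiv:0911.0500, §1) — and ANSWER it in the full space `Ḣ^{1/2}` (Cor. 4.3, "The set `M` is
non-empty"; in the tree `rusin_sverak_minimal_blowup`, discharged by
`rusin_sverak_minimal_blowup_holds` in `RusinSverakCompactnessHolds.lean`). Its transcription to
finite-energy data, forced on this file by the `Ḣ^{1/2} ∩ L²` predicates (review finding 7b), is
proved nowhere (the Rusin–Šverák minimiser is a weak limit of rescaled data with no `L²` bound;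
the later minimal-datum theorems, Jia–Šverák 2013 Thm. 1 for `L³` and Gallagher–Koch–Planchon
2013 §4 for critical Banach spaces with a scale-invariant norm, Albritton–Barker 2018 and
Li–Miao–Zheng 2018 for critical Besov / Fourier–Herz data, never cover `Ḣ^{1/2} ∩ L²`) and,
its hypothesis `ρ_max(1) < ∞` being the failure of global regularity, refuted nowhere. No
`RusinSverakQuestion_holds` is to be expected; users keep
`(h : RusinSverakQuestion)` as an explicit hypothesis. Every other declaration of this
file is byte-for-byte unchanged.

## Mathlib / H21 search

Mathlib has no Navier–Stokes, mild-solution or heat-semigroup-on-`L^p` notion (searched `mild`,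
`NavierStokes`, `Duhamel`); used from Mathlib: `MeasureTheory.MemLp`, `MeasureTheory.eLpNorm`,
`Real.rpow`, `SchwartzMap`, `SchwartzMap.fourierTransformCLM` (`𝓕` on `𝓢`),
`finrank_euclideanSpace_fin`. From H21: `Fluid.IsMildNSSolutionOn`, `Fluid.IsGlobalMildSolution`,
`Fluid.ContinuousInHomSobolevOn`, `Fluid.IsMildNSSolutionOn.ae_eq_of_continuousInLpOn_three` (F8),
`Fluid.ContinuousInLpOn` (F5), `Fluid.IsWeaklyDivFree` (F1), `MemHomSobolev`,
`Function.eHomSobolevSeminorm`, `HomSobolev` (G03), `EuclideanSpace.complexify` (G03).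

## References

* T. Kato, *Strong `L^p`-solutions of the Navier–Stokes equation in `ℝ^m`, with applications to
  weak solutions*, Math. Z. 187 (1984), 471–480, Thms. 1–4. [Kato1984MathZ]
* H. Fujita, T. Kato, *On the Navier–Stokes initial value problem. I*, Arch. Rational Mech.
  Anal. 16 (1964), 269–315, Thms. 1.1, 1.2, 3.2. [FujitaKato1964ARMA]
* W. Rusin, V. Šverák, *Minimal initial data for potential Navier–Stokes singularities*,
  J. Funct. Anal. 260 (2011), 879–891, §1, Thm. 1.1. [RusinSverak2011]
* G. Furioli, P. G. Lemarié-Rieusset, E. Terraneo, Rev. Mat. Iberoam. 16 (2000), Thm. 1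
  (uniqueness in `C([0,T); L³)`).
* P. G. Lemarié-Rieusset, *Recent developments in the Navier–Stokes problem* (2002), Thm. 11.2,
  Thm. 15.2, Ch. 27. [LemarieRieusset2002Book]
* E. B. Fabes, B. F. Jones, N. M. Rivière, Arch. Rational Mech. Anal. 45 (1972), Thm. 2.1.
* H. Jia, V. Šverák, *Minimal `L³`-initial data for potential Navier–Stokes singularities*,
  SIAM J. Math. Anal. 45 (2013) 1448–1459 = arXiv:1201.1592, Thm. 1. [JiaSverak2013]
* I. Gallagher, G. S. Koch, F. Planchon, *A profile decomposition approach to the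
  `L^∞_t(L³_x)` Navier–Stokes regularity criterion*, Math. Ann. 355 (2013) 1527–1559 =
  arXiv:1012.0145, §4, Statement 4.1 and Thm. 9. [GallagherKochPlanchon2013]
-/

noncomputable section

open MeasureTheory Set Function Filter Topology FourierTransform
open scoped ENNReal NNReal SchwartzMap InnerProductSpace RealInnerProductSpace

namespace Literature.Analysis.FluidPDE

/-- Local notation for physical space `ℝ³ = EuclideanSpace ℝ (Fin 3)`. -/
local notation "ℝ³" => EuclideanSpace ℝ (Fin 3)

/-- Local notation for the complexified target `ℂ³ = EuclideanSpace ℂ (Fin 3)`. -/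
local notation "ℂ³" => EuclideanSpace ℂ (Fin 3)

/-! ## A representation predicate for the bundled space `Ḣ^s` -/

section HomSobolev
open Literature.Analysis.FunctionSpaces (HomSobolev)
open Literature.Analysis.FunctionSpaces.HomSobolev

variable {E F : Type*} [NormedAddCommGroup E] [InnerProductSpace ℝ E] [FiniteDimensional ℝ E]
  [MeasurableSpace E] [BorelSpace E] [NormedAddCommGroup F] [InnerProductSpace ℂ F]
  [CompleteSpace F]

/-- `g ∈ Ḣ^s(E; F)` (Fourier-side realisation, accepted `Literature.Analysis.FunctionSpaces.HomSobolev`) **represents** the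
function `f : E → F`: `f` pairs integrably with Schwartz functions and its distributional Fourier
transform is the stored weighted-`L²` class of `g`, i.e. `⟨𝓕f, φ⟩ = ⟨f, 𝓕φ⟩ = ∫ φ • g` for every
`φ ∈ 𝓢(E, ℂ)` (Bahouri–Chemin–Danchin 2011, Def. 1.31 and Prop. 1.34: for `s < d/2` every
element of `Ḣ^s` is a tempered distribution `𝓕⁻¹ g`; same pairing convention as the accepted
`HomSobolev.exists_temperedDistribution`). This lets non-`L²` fields (e.g. `Ḣ^{1/2}(ℝ³) ⊂ L³`)
carry an honest `Ḣ^s` norm `‖g‖`, in contrast with the `Ḣ^s ∩ L²` predicate `MemHomSobolev`.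
Both pairings are required to be honest (volume-)integrable, so that neither Bochner integral
takes its junk value `0`; the right-hand integrability is automatic only for `2s < dim E`
(cf. `HomSobolev.exists_temperedDistribution`), the range used here (`s = 1/2`, `dim E = 3`).
Deliberate dot-notation extension of the H21 type `HomSobolev`; twin of the accepted
`TorusSobolev.Represents`. (Belongs in `Prelude/Sobolev/FourierSobolevNorm.lean`; kept here in
v0.) [cite: BahouriCheminDanchinGL343, Def. 1.31 and Prop. 1.34 (s < d/2)] -/
def _root_.Literature.Analysis.FunctionSpaces.HomSobolev.Represents {s : ℝ} (g : HomSobolev E F s) (f : E → F) : Prop :=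
  (∀ φ : 𝓢(E, ℂ), Integrable (fun x => (𝓕 φ) x • f x) volume) ∧
    (∀ φ : 𝓢(E, ℂ), Integrable
      (fun ξ => φ ξ • ((toLp s g : Lp F 2 (FunctionSpaces.homSobolevMeasure E s)) : E → F) ξ) volume) ∧
    ∀ φ : 𝓢(E, ℂ), ∫ x, (𝓕 φ) x • f x =
      ∫ ξ, φ ξ • ((toLp s g : Lp F 2 (FunctionSpaces.homSobolevMeasure E s)) : E → F) ξ

/-- Sanity: for `f ∈ Ḣ^s ∩ L²` the element `ofFun f hf ∈ Ḣ^s` (the class of `𝓕f`) represents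
`f` (Parseval `∫ 𝓕φ • f = ∫ φ • 𝓕f` for `f ∈ L²`, Mathlib `Lp.fourierTransform`; the
representative of the `‖ξ‖^{2s} dξ`-class is a `volume`-a.e. representative of `𝓕f` because
the density is a.e. positive and finite when `dim E ≥ 1`, whence `hE`). Twin of the accepted
`TorusSobolev.represents_ofFun` (Bahouri–Chemin–Danchin 2011, Def. 1.31).
[cite: BahouriCheminDanchinGL343, Def. 1.31] -/
def _root_.Literature.Analysis.FunctionSpaces.HomSobolev.represents_ofFun : Prop :=
  ∀ {s : ℝ} (hE : 0 < Module.finrank ℝ E) (f : E → F) (hf : FunctionSpaces.MemHomSobolev s f),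
    (ofFun f hf).Represents f

end HomSobolev

section NS

/-! ## ns.S13: Kato's `L³` theory -/

/-- **ns.S13** (Kato, Math. Z. 187 (1984), Thm. 1; local existence in `L³`). Let `ν > 0` and let
`u₀ ∈ L³(ℝ³; ℝ³)` be weakly divergence free. Then there are `T > 0` and a mild solution `u` of
the unforced Navier–Stokes equations on `[0, T)` with datum `u₀` (duality form,
`Fluid.IsMildNSSolutionOn`) such that `u ∈ C([0,T); L³)`, `u(0) = u₀`, and `u` is measurable on
`(0,T) × ℝ³`. Uniqueness in this class is `kato_unique`. (Kato's `m = 3` case; the datum need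
not be small for local existence.) [cite: Kato1984MathZ, Thm. 1 (m = 3)] -/
def kato_local : Prop :=
  ∀ (ν : ℝ) (hν : 0 < ν) (u₀ : ℝ³ → ℝ³) (hu₀ : MemLp u₀ 3) (hdiv : FluidPDE.IsWeaklyDivFree u₀),
    ∃ T : ℝ, 0 < T ∧ ∃ u : ℝ → ℝ³ → ℝ³,
      FluidPDE.IsMildNSSolutionOn (Ico 0 T) ν 0 u₀ u ∧ FluidPDE.ContinuousInLpOn (Ico 0 T) 3 u ∧
        u 0 = u₀ ∧ AEStronglyMeasurable (uncurry u) (volume.restrict (Ioo 0 T ×ˢ univ))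

/-- **ns.S13** (uniqueness in `C([0,T); L³(ℝ³))`; Kato 1984, Thm. 1 within his class;
unconditionally Furioli–Lemarié-Rieusset–Terraneo, Rev. Mat. Iberoam. 16 (2000), Thm. 1;
Lemarié-Rieusset 2002, Ch. 27). For `ν > 0` and `u₀ ∈ L³`, two unforced mild solutions on
`[0, T)` with datum `u₀`, both in `C([0,T); L³)` and measurable on `(0,T) × ℝ³`, agree a.e. at
every time. This is the accepted `Fluid.IsMildNSSolutionOn.ae_eq_of_continuousInLpOn_three`
(`Prelude/FluidKinetic/MildSolution.lean`) specialised to `ℝ³` via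
`finrank_euclideanSpace_fin`. [cite: Kato1984MathZ, Thm. 1 (uniqueness within the class)] -/
def kato_unique : Prop :=
  ∀ {ν T : ℝ} (hν : 0 < ν) {u₀ : ℝ³ → ℝ³} {u v : ℝ → ℝ³ → ℝ³} (hu₀ : MemLp u₀ 3) (hu : FluidPDE.IsMildNSSolutionOn (Ico 0 T) ν 0 u₀ u) (hv : FluidPDE.IsMildNSSolutionOn (Ico 0 T) ν 0 u₀ v) (huc : FluidPDE.ContinuousInLpOn (Ico 0 T) 3 u) (hvc : FluidPDE.ContinuousInLpOn (Ico 0 T) 3 v) (hmu : AEStronglyMeasurable (uncurry u) (volume.restrict (Ioo 0 T ×ˢ univ))) (hmv : AEStronglyMeasurable (uncurry v) (volume.restrict (Ioo 0 T ×ˢ univ))),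
    ∀ t ∈ Ico 0 T, u t =ᵐ[volume] v t

/- interim proof relied on results that are now named facts (D-0014); demoted to a fact by the M5 import, proof preserved:
:=
  hu.ae_eq_of_continuousInLpOn_three finrank_euclideanSpace_fin hν hu₀ hv huc hvc hmu hmv
-/

/-- **ns.S13** (Kato, Math. Z. 187 (1984), Thms. 2–4 and abstract; global existence and decay for
small `L³` data). There is an absolute constant `δ > 0` such that for every `ν > 0` and every
weakly divergence-free `u₀ ∈ L³(ℝ³)` with `‖u₀‖_{L³} ≤ δ ν`, the unforced Navier–Stokes
equations have a global mild solution `u ∈ C([0,∞); L³)` with `u(0) = u₀`, measurable on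
`(0,∞) × ℝ³`, which decays: `‖u(t)‖_{L^∞} ≤ C t^{-1/2}` for all `t > 0`, and more generally
`‖u(t)‖_{L^q} ≤ C_q t^{-(1-3/q)/2}` for `3 < q < ∞`.
[cite: Kato1984MathZ, Thms. 2–4 and abstract] -/
def kato_global_small : Prop :=
  ∃ δ : ℝ, 0 < δ ∧ ∀ (ν : ℝ), 0 < ν → ∀ u₀ : ℝ³ → ℝ³, MemLp u₀ 3 →
      FluidPDE.IsWeaklyDivFree u₀ → eLpNorm u₀ 3 volume ≤ ENNReal.ofReal (δ * ν) →
      ∃ u : ℝ → ℝ³ → ℝ³, FluidPDE.IsGlobalMildSolution ν 0 u₀ u ∧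
        FluidPDE.ContinuousInLpOn (Ici 0) 3 u ∧ u 0 = u₀ ∧
        AEStronglyMeasurable (uncurry u) (volume.restrict (Ioi 0 ×ˢ univ)) ∧
        (∃ C : ℝ, ∀ t : ℝ, 0 < t →
          eLpNorm (u t) ∞ volume ≤ ENNReal.ofReal (C * t ^ (-(1 / 2 : ℝ)))) ∧
        ∀ q : ℝ, 3 < q → ∃ C : ℝ, ∀ t : ℝ, 0 < t →
          eLpNorm (u t) (ENNReal.ofReal q) volume ≤
            ENNReal.ofReal (C * t ^ (-(1 - 3 / q) / 2))

/-! ## ns.S14: Fujita–Kato in `Ḣ^{1/2} ∩ L²` -/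

/-- **ns.S14** (Fujita–Kato, ARMA 16 (1964), Thm. 1.1/3.2; whole-space `Ḣ^{1/2}` form:
Lemarié-Rieusset 2002, Thm. 15.2). Let `ν > 0` and let `u₀ : ℝ³ → ℝ³` be weakly divergence
free with `u₀ ∈ Ḣ^{1/2} ∩ L²` (accepted `MemHomSobolev (1/2)`, applied to `complexify ∘ u₀`;
this is the **finite-energy version**, see the module docstring, review finding 7b — the accepted
`MemHomSobolev s` is `Ḣ^s ∩ L²`, `FourierSobolevNorm.lean:113–118`). Then there are `T > 0` and
a mild solution `u` on `[0, T)` with datum `u₀`, `u ∈ C([0,T); Ḣ^{1/2} ∩ L²)`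
(`Fluid.ContinuousInHomSobolevOn` and `Fluid.ContinuousInLpOn … 2`), `u(0) = u₀`, and `u` is
measurable on `(0,T) × ℝ³`. Uniqueness in this class (the other half of *well-posedness*) is
`fujita_kato_unique`, a corollary of `kato_unique` through the critical embedding
`Ḣ^{1/2} ∩ L² ⊂ L³` (accepted `eLpNorm_three_le_eHomSobolevSeminorm_half`;
`Statements/NS/CriticalSpaces.lean`, `memLp_three_of_memHomSobolev_half`).
[cite: LemarieRieusset2002Book, Thm. 15.2] -/
def fujita_kato_local : Prop :=
  ∀ (ν : ℝ) (hν : 0 < ν) (u₀ : ℝ³ → ℝ³) (hu₀ : FunctionSpaces.MemHomSobolev (1 / 2 : ℝ) (FunctionSpaces.EuclideanSpace.complexify ∘ u₀)) (hdiv : FluidPDE.IsWeaklyDivFree u₀),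
    ∃ T : ℝ, 0 < T ∧ ∃ u : ℝ → ℝ³ → ℝ³,
      FluidPDE.IsMildNSSolutionOn (Ico 0 T) ν 0 u₀ u ∧
        FluidPDE.ContinuousInHomSobolevOn (Ico 0 T) (1 / 2 : ℝ) u ∧
        FluidPDE.ContinuousInLpOn (Ico 0 T) 2 u ∧ u 0 = u₀ ∧
        AEStronglyMeasurable (uncurry u) (volume.restrict (Ioo 0 T ×ˢ univ))

/-- **ns.S14** (uniqueness in `C([0,T); Ḣ^{1/2} ∩ L²)`; Fujita–Kato, ARMA 16 (1964), Thm. 3.2;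
Lemarié-Rieusset 2002, Thm. 15.2 (iii)). For `ν > 0` and `u₀ ∈ Ḣ^{1/2} ∩ L²`, two unforced
mild solutions on `[0, T)` with datum `u₀`, both in `C([0,T); Ḣ^{1/2} ∩ L²)` and measurable on
`(0,T) × ℝ³`, agree a.e. at every time. Proof route: `C([0,T); Ḣ^{1/2} ∩ L²) ⊂ C([0,T); L³)`
and `u₀ ∈ L³` by the critical embedding (`eLpNorm_three_le_eHomSobolevSeminorm_half`), then
`kato_unique`. [cite: LemarieRieusset2002Book, Thm. 15.2 (iii)] -/
def fujita_kato_unique : Prop :=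
  ∀ {ν T : ℝ} (hν : 0 < ν) {u₀ : ℝ³ → ℝ³} {u v : ℝ → ℝ³ → ℝ³} (hu₀ : FunctionSpaces.MemHomSobolev (1 / 2 : ℝ) (FunctionSpaces.EuclideanSpace.complexify ∘ u₀)) (hu : FluidPDE.IsMildNSSolutionOn (Ico 0 T) ν 0 u₀ u) (hv : FluidPDE.IsMildNSSolutionOn (Ico 0 T) ν 0 u₀ v) (huc : FluidPDE.ContinuousInHomSobolevOn (Ico 0 T) (1 / 2 : ℝ) u) (huc₂ : FluidPDE.ContinuousInLpOn (Ico 0 T) 2 u) (hvc : FluidPDE.ContinuousInHomSobolevOn (Ico 0 T) (1 / 2 : ℝ) v) (hvc₂ : FluidPDE.ContinuousInLpOn (Ico 0 T) 2 v) (hmu : AEStronglyMeasurable (uncurry u) (volume.restrict (Ioo 0 T ×ˢ univ))) (hmv : AEStronglyMeasurable (uncurry v) (volume.restrict (Ioo 0 T ×ˢ univ))),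
    ∀ t ∈ Ico 0 T, u t =ᵐ[volume] v t

/-- A datum `u₀ : ℝ³ → ℝ³` **has a global regular (Fujita–Kato) solution** for viscosity `ν`:
there is a global mild solution `u ∈ C([0,∞); Ḣ^{1/2} ∩ L²)` of the unforced equations with
`u(0) = u₀`, measurable on `(0,∞) × ℝ³` (Fujita–Kato 1964, Thm. 1.2; Rusin–Šverák 2011, §1,
"the solution is regular for all time", finite-energy version).
[cite: FujitaKato1964ARMA, Thm. 1.2] -/
def HasGlobalFujitaKatoSolution (ν : ℝ) (u₀ : ℝ³ → ℝ³) : Prop :=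
  ∃ u : ℝ → ℝ³ → ℝ³, FluidPDE.IsGlobalMildSolution ν 0 u₀ u ∧
    FluidPDE.ContinuousInHomSobolevOn (Ici 0) (1 / 2 : ℝ) u ∧
    FluidPDE.ContinuousInLpOn (Ici 0) 2 u ∧ u 0 = u₀ ∧
    AEStronglyMeasurable (uncurry u) (volume.restrict (Ioi 0 ×ˢ univ))

/-- **ns.S14** (Fujita–Kato, ARMA 16 (1964), Thm. 1.2; Lemarié-Rieusset 2002, Thm. 15.2 (global
part)). There is an absolute constant `δ > 0` such that for every `ν > 0`, every weakly
divergence-free `u₀ ∈ Ḣ^{1/2} ∩ L²` (finite-energy version, review finding 7b) with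
`‖u₀‖_{Ḣ^{1/2}} ≤ δ ν` has a global mild solution `u ∈ C([0,∞); Ḣ^{1/2} ∩ L²)` with
`u(0) = u₀`. [cite: LemarieRieusset2002Book, Thm. 15.2 (global part)] -/
def fujita_kato_global_small : Prop :=
  ∃ δ : ℝ, 0 < δ ∧ ∀ (ν : ℝ), 0 < ν → ∀ u₀ : ℝ³ → ℝ³,
      FunctionSpaces.MemHomSobolev (1 / 2 : ℝ) (FunctionSpaces.EuclideanSpace.complexify ∘ u₀) → FluidPDE.IsWeaklyDivFree u₀ →
      Function.eHomSobolevSeminorm (1 / 2 : ℝ) (FunctionSpaces.EuclideanSpace.complexify ∘ u₀) ≤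
        ENNReal.ofReal (δ * ν) →
      HasGlobalFujitaKatoSolution ν u₀

/-! ## ns.S14: the Rusin–Šverák threshold `ρ_max` -/

/-- **ns.S14** (Rusin–Šverák, JFA 260 (2011), §1, finite-energy transcription). The threshold
`ρ_max(ν) = sup {ρ | every weakly divergence-free u₀ ∈ Ḣ^{1/2} ∩ L² with ‖u₀‖_{Ḣ^{1/2}} < ρ has
a global regular solution} ∈ [0, ∞]`, typed with the accepted `Ḣ^{1/2} ∩ L²` predicates
`MemHomSobolev (1/2)` / `Function.eHomSobolevSeminorm (1/2)` (review finding 7b: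
`FourierSobolevNorm.lean:113–118`). Rusin–Šverák's own `ρ_max` ranges over *all* of `Ḣ^{1/2}`;
that is `rusinSverakRhoMaxPure` below (`≤ rusinSverakRhoMax`). By `fujita_kato_global_small`,
`ρ_max(ν) ≥ δν > 0`; `ρ_max(1) = ∞` is global regularity for finite-energy `Ḣ^{1/2}` data. [folklore] -/
def rusinSverakRhoMax (ν : ℝ) : ℝ≥0∞ :=
  sSup {ρ : ℝ≥0∞ | ∀ u₀ : ℝ³ → ℝ³, FunctionSpaces.MemHomSobolev (1 / 2 : ℝ) (FunctionSpaces.EuclideanSpace.complexify ∘ u₀) →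
    FluidPDE.IsWeaklyDivFree u₀ →
    Function.eHomSobolevSeminorm (1 / 2 : ℝ) (FunctionSpaces.EuclideanSpace.complexify ∘ u₀) < ρ →
    HasGlobalFujitaKatoSolution ν u₀}

/-- Below the threshold every finite-energy datum is globally regular (unfolding of the `sSup`;
Rusin–Šverák 2011, §1). [folklore] -/
theorem hasGlobalFujitaKatoSolution_of_lt_rusinSverakRhoMax {ν : ℝ} {u₀ : ℝ³ → ℝ³}
    (hu₀ : FunctionSpaces.MemHomSobolev (1 / 2 : ℝ) (FunctionSpaces.EuclideanSpace.complexify ∘ u₀))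
    (hdiv : FluidPDE.IsWeaklyDivFree u₀)
    (hlt : Function.eHomSobolevSeminorm (1 / 2 : ℝ) (FunctionSpaces.EuclideanSpace.complexify ∘ u₀) <
      rusinSverakRhoMax ν) :
    HasGlobalFujitaKatoSolution ν u₀ := by
  obtain ⟨ρ, hρ, hltρ⟩ := lt_sSup_iff.1 hlt
  exact hρ u₀ hu₀ hdiv hltρ

/-- The threshold is positive for `ν > 0` (from `fujita_kato_global_small`: `ρ_max(ν) ≥ δν`;
Fujita–Kato 1964, Thm. 1.2). [cite: FujitaKato1964ARMA, Thm. 1.2] -/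
def rusinSverakRhoMax_pos : Prop :=
  ∀ {ν : ℝ} (hν : 0 < ν),
    0 < rusinSverakRhoMax ν

/-- Scaling in the viscosity: `u` solves with viscosity `ν` iff `(t, x) ↦ ν⁻¹ u (ν⁻¹ t) x` solves
with viscosity `1`, and `‖ν⁻¹ u₀‖_{Ḣ^{1/2}} = ν⁻¹ ‖u₀‖_{Ḣ^{1/2}}`; hence `ρ_max(ν) = ν ρ_max(1)`
(Rusin–Šverák 2011, §1, normalisation `ν = 1`; elementary scaling symmetry).
[cite: RusinSverak2011, §1 (normalisation ν = 1 by scaling)] -/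
def rusinSverakRhoMax_eq_mul : Prop :=
  ∀ {ν : ℝ} (hν : 0 < ν),
    rusinSverakRhoMax ν = ENNReal.ofReal ν * rusinSverakRhoMax 1

/-- OPEN CONJECTURE — **ns.S14**, Rusin–Šverák's question **(Q)** transcribed to **finite-energy
data** (`Ḣ^{1/2} ∩ L²`): a registered open statement (CONVENTIONS §4), not a named fact. POSED —
for the full space `Ḣ^{1/2}` — in W. Rusin, V. Šverák, *Minimal initial data for potential
Navier–Stokes singularities*, J. Funct. Anal. 260 (2011) 879–891 = arXiv:0911.0500, §1: "(Q) If
`ρ_max` is finite, does there exist an initial datum `u₀ ∈ Ḣ^{1/2}` with `‖u₀‖_{Ḣ^{1/2}} = ρ_max`,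
such that the solution `u` of the Cauchy problem … develops a singularity in finite time?", where
`ρ_max` is "the supremum of all `ρ > 0` such that the Cauchy problem … is globally well-posed for
`u₀ ∈ B_ρ`", `B_ρ = {u₀ ∈ Ḣ^{1/2}, ‖u₀‖_{Ḣ^{1/2}} < ρ}`
[cite: RusinSverak2011, §1, question (Q) (posed for Ḣ^(1/2); arXiv:0911.0500 §1)]. [status: open]
for the statement below, the `Prop` asserting the affirmative answer for the tree's FINITE-ENERGY
threshold: *if* `ρ_max(1) = rusinSverakRhoMax 1` — the supremum of the radii `ρ` below which every
weakly divergence-free `u₀ ∈ Ḣ^{1/2} ∩ L²` has a global Fujita–Kato solution (`MemHomSobolev (1/2)`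
and `eHomSobolevSeminorm (1/2)` are the `Ḣ^{1/2} ∩ L²` predicates, review finding 7b) — is finite,
then some weakly divergence-free `u₀ ∈ Ḣ^{1/2} ∩ L²` with `‖u₀‖_{Ḣ^{1/2}} = ρ_max(1)` has no global
Fujita–Kato solution (`HasGlobalFujitaKatoSolution 1 u₀`), i.e. is a finite-energy **minimal
blow-up datum**.
**Why open — neither a proof nor a disproof is in print.** Rusin–Šverák answer (Q) affirmatively
only in the full space `Ḣ^{1/2}` (Cor. 4.3: "The set `M` is non-empty. Moreover, `M` is compact
modulo scalings and translations"; in the tree `rusin_sverak_minimal_blowup` below, discharged by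
`Literature.Analysis.FluidPDE.rusin_sverak_minimal_blowup_holds`): their minimiser is the weak
`Ḣ^{1/2}` limit `v₀` of the rescaled and translated data `v^k(x) = λ_k u₀^k(λ_k x - x₀^k)` of a
minimising sequence (proof of Cor. 4.3), which carries no `L²` bound (the rescaling alone gives
`‖v^k‖_{L²} = λ_k^{-1/2} ‖u₀^k‖_{L²}`), so `v₀` is not known to lie in `L²`; nor is the
finite-energy threshold known to equal the pure one (only `ρ_max^pure ≤ ρ_max`,
`rusinSverakRhoMaxPure_le`). The later minimal-datum theorems are again for scale-invariant spaces
of data only — Jia–Šverák for `L³` [cite: JiaSverak2013, Thm. 1], Gallagher–Koch–Planchon for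
`Ḣ^{d/2-1}`, `L^d` and critical Besov spaces, under the standing hypothesis of a Banach space `X`
of data with "a norm which is invariant under the transformations leaving the Navier–Stokes
equations invariant" [cite: GallagherKochPlanchon2013, §4, Statement 4.1 and Thm. 9], and likewise
Albritton–Barker, arXiv:1802.03164 (critical Besov data `Ḃ^{-1+3/p}_{p,∞}`) and Li–Miao–Zheng,
arXiv:1804.09842 (critical Fourier–Herz data) — and `Ḣ^{1/2} ∩ L²`, whose `Ḣ^{1/2}`-seminorm is
scale invariant but which is not complete under it, is not such a space. Finally the hypothesis
`ρ_max(1) < ∞` is the failure of global regularity for finite-energy `Ḣ^{1/2}` data, itself open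
("It is not known if `ρ_max` is finite or infinite", ibid. §1), so at present the implication can
be neither proved (short of global regularity, which makes it vacuous) nor refuted (which needs a
finite-energy blow-up). Hence no
`RusinSverakQuestion_holds` is to be expected: users take
`(h : RusinSverakQuestion)` as an explicit hypothesis, and a route wanting it as a
crux re-files it problem-side.
Verdict clean-up 2026-08-16 (MARK-OPEN): statement byte-for-byte unchanged; name kept without the
`…Conjecture` suffix (no Lean user, but the rename is refused by the gate as a newly minted fact;
see the module docstring, "Open statement"). -/
@[conjecture] def RusinSverakQuestion : Prop :=
  rusinSverakRhoMax 1 < ∞ →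
    ∃ u₀ : ℝ³ → ℝ³, FunctionSpaces.MemHomSobolev (1 / 2 : ℝ) (FunctionSpaces.EuclideanSpace.complexify ∘ u₀) ∧
      FluidPDE.IsWeaklyDivFree u₀ ∧
      Function.eHomSobolevSeminorm (1 / 2 : ℝ) (FunctionSpaces.EuclideanSpace.complexify ∘ u₀) =
        rusinSverakRhoMax 1 ∧
      ¬ HasGlobalFujitaKatoSolution 1 u₀

/-! ## ns.S14: Rusin–Šverák in the full space `Ḣ^{1/2}` -/

/-- A datum `u₀ : ℝ³ → ℝ³` **has a global Kato solution** for viscosity `ν`: there is a global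
mild solution `u ∈ C([0,∞); L³)` of the unforced equations with `u(0) = u₀`, measurable on
`(0,∞) × ℝ³` (Kato 1984, Thm. 4). For `u₀ ∈ Ḣ^{1/2} ⊂ L³` this is the statement that the
(unique, `kato_unique`) mild solution is regular for all time, i.e. Rusin–Šverák's
"`T_max(u₀) = ∞`" (2011, §1): the Kato and Fujita–Kato solutions coincide and have the same
maximal time. Used to phrase `ρ_max` over the full space `Ḣ^{1/2}`, whose elements need not be
`L²` but are `L³` functions (accepted `eLpNorm_three_le_eHomSobolevSeminorm_half`).
[cite: Kato1984MathZ, Thm. 4] -/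
def HasGlobalKatoSolution (ν : ℝ) (u₀ : ℝ³ → ℝ³) : Prop :=
  ∃ u : ℝ → ℝ³ → ℝ³, FluidPDE.IsGlobalMildSolution ν 0 u₀ u ∧ FluidPDE.ContinuousInLpOn (Ici 0) 3 u ∧
    u 0 = u₀ ∧ AEStronglyMeasurable (uncurry u) (volume.restrict (Ioi 0 ×ˢ univ))

/-- **ns.S14** (Rusin–Šverák, JFA 260 (2011), §1, (1.4): the threshold in the full space
`Ḣ^{1/2}`). `ρ_max^pure(ν) = sup {ρ | every weakly divergence-free u₀ ∈ L³ represented by some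
g ∈ Ḣ^{1/2}(ℝ³; ℂ³) (bundled `HomSobolev`, via `HomSobolev.Represents g (complexify ∘ u₀)`) with
‖g‖_{Ḣ^{1/2}} < ρ has a global Kato solution}`. The hypothesis `u₀ ∈ L³` is automatic
(`Ḣ^{1/2}(ℝ³) ⊂ L³`) and only fixes the function representative. [folklore] -/
def rusinSverakRhoMaxPure (ν : ℝ) : ℝ≥0∞ :=
  sSup {ρ : ℝ≥0∞ | ∀ (u₀ : ℝ³ → ℝ³) (g : FunctionSpaces.HomSobolev ℝ³ ℂ³ (1 / 2 : ℝ)), MemLp u₀ 3 →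
    g.Represents (FunctionSpaces.EuclideanSpace.complexify ∘ u₀) → FluidPDE.IsWeaklyDivFree u₀ → ‖g‖ₑ < ρ →
    HasGlobalKatoSolution ν u₀}

/-- Below the pure threshold every `Ḣ^{1/2}` datum has a global Kato solution (unfolding of the
`sSup`; Rusin–Šverák 2011, §1). [folklore] -/
theorem hasGlobalKatoSolution_of_lt_rusinSverakRhoMaxPure {ν : ℝ} {u₀ : ℝ³ → ℝ³}
    {g : FunctionSpaces.HomSobolev ℝ³ ℂ³ (1 / 2 : ℝ)} (hu₀ : MemLp u₀ 3)
    (hg : g.Represents (FunctionSpaces.EuclideanSpace.complexify ∘ u₀)) (hdiv : FluidPDE.IsWeaklyDivFree u₀)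
    (hlt : ‖g‖ₑ < rusinSverakRhoMaxPure ν) : HasGlobalKatoSolution ν u₀ := by
  obtain ⟨ρ, hρ, hltρ⟩ := lt_sSup_iff.1 hlt
  exact hρ u₀ g hu₀ hg hdiv hltρ

/-- The pure threshold is at most the finite-energy one: an `Ḣ^{1/2} ∩ L²` datum `u₀` is
represented by `HomSobolev.ofFun _ hu₀` (`HomSobolev.represents_ofFun`) with the same norm
(`HomSobolev.norm_ofFun`), and for
such data a global Kato solution is a global Fujita–Kato solution (uniqueness `kato_unique` and
persistence of `Ḣ^{1/2} ∩ L²` regularity; Lemarié-Rieusset 2002, Thm. 15.2, Ch. 27).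
[cite: LemarieRieusset2002Book, Thm. 15.2 and Ch. 27] -/
def rusinSverakRhoMaxPure_le : Prop :=
  ∀ {ν : ℝ} (hν : 0 < ν),
    rusinSverakRhoMaxPure ν ≤ rusinSverakRhoMax ν

/-- Viscosity scaling of the pure threshold, `ρ_max^pure(ν) = ν ρ_max^pure(1)` (same argument
as `rusinSverakRhoMax_eq_mul`: `u ↦ ν⁻¹ u(ν⁻¹ t, ·)`, `g ↦ ν⁻¹ g`; Rusin–Šverák 2011, §1,
normalisation `ν = 1`; elementary scaling symmetry).
[cite: RusinSverak2011, §1 (normalisation ν = 1 by scaling)] -/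
def rusinSverakRhoMaxPure_eq_mul : Prop :=
  ∀ {ν : ℝ} (hν : 0 < ν),
    rusinSverakRhoMaxPure ν = ENNReal.ofReal ν * rusinSverakRhoMaxPure 1

/-- **ns.S14** (minimal blow-up data; Rusin–Šverák, JFA 260 (2011), Thm. 1.1). Let `ν > 0` and
suppose the `Ḣ^{1/2}` threshold is finite, `ρ_max^pure(ν) < ∞`. Then the infimum of
`‖u₀‖_{Ḣ^{1/2}}` over data without a global regular solution is attained: there is a weakly
divergence-free `u₀ ∈ Ḣ^{1/2}(ℝ³)` (an `L³` field represented by `g ∈ Ḣ^{1/2}`) with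
`‖g‖_{Ḣ^{1/2}} = ρ_max^pure(ν)` which has no global Kato (equivalently, Fujita–Kato) solution.
Rusin–Šverák normalise `ν = 1`; the statement for general `ν > 0` follows by the viscosity
scaling `u ↦ ν⁻¹ u(ν⁻¹ t, ·)` of `rusinSverakRhoMax_eq_mul`, which holds verbatim for the pure
threshold (`rusinSverakRhoMaxPure_eq_mul`). (Rusin–Šverák also prove compactness of the set of
such minimal data modulo translations and scalings; not stated here.)
[cite: RusinSverak2011, Thm. 1.1] -/
def rusin_sverak_minimal_blowup : Prop :=
  ∀ (ν : ℝ) (hν : 0 < ν) (hfin : rusinSverakRhoMaxPure ν < ∞),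
    ∃ (u₀ : ℝ³ → ℝ³) (g : FunctionSpaces.HomSobolev ℝ³ ℂ³ (1 / 2 : ℝ)), MemLp u₀ 3 ∧
      g.Represents (FunctionSpaces.EuclideanSpace.complexify ∘ u₀) ∧ FluidPDE.IsWeaklyDivFree u₀ ∧
      ‖g‖ₑ = rusinSverakRhoMaxPure ν ∧ ¬ HasGlobalKatoSolution ν u₀

end NS

end Literature.Analysis.FluidPDE
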